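import Literature.NumberTheory.PAdicHodge.UnramifiedResidueFieldEmbedding
import Literature.NumberTheory.PAdicHodge.AinfRamifiedWittTwistedTheta
import Literature.NumberTheory.PAdicHodge.PadicBaseField
import Mathlib.Analysis.Normed.Unbundled.SpectralNorm
import Mathlib.FieldTheory.Finite.Basic
import Mathlib.Algebra.Algebra.ZMod
import HarnessLib

/-!
# Classification of the `ℚ_p`-embeddings of a `p`-adic field on `W(k_F)`

Topic `Literature/NumberTheory/PAdicHodge`; third instalment of solo-Langlands-informed Stage E2.9c (memo
`work/s113/E29.md` §5). Let `F/ℚ_p` be a `p`-adic field, `F̄ = NormedAlgClosure F ⊆ ℂ_F`, `k̄` the residue field of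
`𝒪̂_{F^nr}`, `W(k_F) := W(k̄)^{Γ_F}` (tree `wittFixed`) with its embedding `W(k_F) → 𝒪_F` (tree `wittFixedToF`), and
`c_j = θ ∘ φ^j : W(k_F) → 𝒪_{ℂ_F}` the twisted coefficient characters (tree `twistCoeff`). For a `ℚ_p`-algebra map
`e : F → F̄` (a "conjugate embedding") we prove:

* §1 **`ℚ_p`-embeddings are isometric**: `‖e x‖ = ‖x‖` (`norm_algHom_eq`; both sides are absolute values on the
  algebraic extension `F/ℚ_p` extending `‖·‖_{ℚ_p}`, `ℚ_p` complete, so both are the spectral norm — Mathlib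
  `spectralNorm_unique_field_norm_ext`), hence `‖e x‖ ≤ 1` for `x ∈ 𝒪_F` (`norm_algHom_le_one`).
* §2 the Teichmüller system `x ↦ [ι x] ∈ W(k_F)` of `k_F` (`teichmullerFixed`: multiplicative, `[ι x]^q = [ι x]`,
  additive modulo `p`).
* §3 **the residue permutation of `e`**: `e [ι x]` is a root of `X^q − X` in `ℂ_F`, hence `= [ι (b_e x)]` for a unique
  `b_e x ∈ k_F` (tree `exists_eq_wittToC_teichmuller_of_pow_eq`), and `b_e : k_F → k_F` is a ring homomorphism
  (`residuePerm`; additivity: `[a] + [b] ≡ [a + b] (mod p)` and Teichmüller lifts are separated modulo `𝔪_{ℂ_F}`).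
* §4 **`b_e` is a power of Frobenius** (`exists_residuePerm_eq_pow`: every ring endomorphism of the finite field `k_F`
  is `x ↦ x^{p^n}`, Mathlib `FiniteField.bijective_frobeniusAlgHom_pow` over `𝔽_p`), so `e [a] = c_n [a]` on
  Teichmüller lifts.
* §5 **rigidity**: two ring maps `W(k_F) → 𝒪_{ℂ_F}` agreeing on Teichmüller lifts agree (`ringHom_wittFixed_ext`:
  Teichmüller expansion to depth `m` leaves a difference in `p^m 𝒪_{ℂ_F}` for every `m`).
* §6 ★ **Classification** (`exists_algHom_eq_twistCoeff`): if `q_F = p^f` then for every `ℚ_p`-embedding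
  `e : F → F̄` there is `j < f` with `e(w) = c_j(w) = θ(φ^j w)` in `ℂ_F` for all `w ∈ W(k_F)` — i.e. `e|_{F₀}` is a
  power of the Frobenius of the maximal unramified subfield `F₀ = W(k_F)[1/p]`.

Definitions (reviewed): `algHomAbsValue`, `teichmullerFixed`, `algHomWittC`, `residuePerm`. No named facts, no instances, no `sorry`.

## References
* J.-P. Serre, *Local Fields* (GTM 67, 1979), Ch. II §4 Prop. 8, §5 Thm. 3–4 and Cor., Ch. III §5 Thm. 3. [SerreLocalFields1979]
* J. Neukirch, *Algebraic Number Theory* (1999), Ch. II (4.8)–(4.9) (uniqueness/continuity of extensions of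
  absolute values), (7.12)–(7.13) (unramified extensions and Frobenius). [NeukirchANT1999]
* J.-M. Fontaine, *Le corps des périodes p-adiques*, Astérisque 223 (1994), Exp. II §1.2. [FontaineAsterisque223III]
-/

noncomputable section

open IsLocalRing WittVector

namespace Literature.NumberTheory.PAdicHodge

open Literature.NumberTheory.GaloisRepresentations
open Literature.NumberTheory.GaloisRepresentations.IsNonarchimedeanLocalField
open Field ValuativeRel

variable {F : Type} [Field F] [ValuativeRel F] [TopologicalSpace F] [IsNonarchimedeanLocalField F] [CharZero F]
  {p : ℕ} [Fact p.Prime]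

/-! ## §1 `ℚ_p`-embeddings `F → F̄` are isometric -/

/-- The absolute value `x ↦ ‖e x‖` of `F` defined by a `ℚ_p`-algebra map `e : F → F̄`. Auxiliary.
[cite: NeukirchANT1999, Ch. II (4.8)] -/
def algHomAbsValue (hp : valuation F p < 1) (e : F →ₐ[PadicBase F p hp] NormedAlgClosure F) : AbsoluteValue F ℝ where
  toFun x := ‖e x‖
  map_mul' x y := by simp only [map_mul, norm_mul]
  nonneg' x := norm_nonneg _
  eq_zero' x := by
    rw [norm_eq_zero]
    exact map_eq_zero_iff e (RingHom.injective (e : F →+* NormedAlgClosure F))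
  add_le' x y := by simp only [map_add]; exact norm_add_le _ _

/-- Unfolding `algHomAbsValue`. [cite: NeukirchANT1999, Ch. II (4.8)] -/
theorem algHomAbsValue_apply (hp : valuation F p < 1) (e : F →ₐ[PadicBase F p hp] NormedAlgClosure F) (x : F) :
    algHomAbsValue hp e x = ‖e x‖ := rfl

/-- ★ **A `ℚ_p`-algebra map `e : F → F̄` is isometric: `‖e x‖ = ‖x‖`** (the right side written as the norm of `x` in
`F̄`). Both `x ↦ ‖e x‖` and `x ↦ ‖x‖` are absolute values on the algebraic extension `F` of the complete field `ℚ_p`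
extending `‖·‖_{ℚ_p}`, hence both are the spectral norm (Mathlib `spectralNorm_unique_field_norm_ext`).
[cite: NeukirchANT1999, Ch. II (4.8)] -/
theorem norm_algHom_eq (hp : valuation F p < 1) (e : F →ₐ[PadicBase F p hp] NormedAlgClosure F) (x : F) :
    ‖e x‖ = ‖algebraMap F (NormedAlgClosure F) x‖ := by
  have h1 : ∀ c : PadicBase F p hp, algHomAbsValue hp e (algebraMap (PadicBase F p hp) F c) = ‖c‖ := fun c => by
    rw [algHomAbsValue_apply, e.commutes, PadicBase.norm_algebraMap_closure]
  have h2 : ∀ c : PadicBase F p hp,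
      algHomAbsValue hp (IsScalarTower.toAlgHom (PadicBase F p hp) F (NormedAlgClosure F))
        (algebraMap (PadicBase F p hp) F c) = ‖c‖ := fun c => by
    rw [algHomAbsValue_apply, IsScalarTower.toAlgHom_apply, ← PadicBase.algebraMap_closure_eq,
      PadicBase.norm_algebraMap_closure]
  rw [← algHomAbsValue_apply hp e, spectralNorm_unique_field_norm_ext h1 x, ← spectralNorm_unique_field_norm_ext h2 x,
    algHomAbsValue_apply, IsScalarTower.toAlgHom_apply]

/-- `‖e x‖ = ‖x‖` in `ℂ_F`. [cite: NeukirchANT1999, Ch. II (4.8)] -/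
theorem norm_coe_algHom_eq (hp : valuation F p < 1) (e : F →ₐ[PadicBase F p hp] NormedAlgClosure F) (x : F) :
    ‖((e x : NormedAlgClosure F) : CompletedAlgClosure F)‖ = ‖algebraMap F (CompletedAlgClosure F) x‖ := by
  rw [UniformSpace.Completion.norm_coe, norm_algHom_eq, CompletedAlgClosure.algebraMap_eq_coe,
    UniformSpace.Completion.norm_coe]

/-- **`‖e x‖ ≤ 1` for `x ∈ 𝒪_F`.** [cite: NeukirchANT1999, Ch. II (4.8)] -/
theorem norm_algHom_le_one (hp : valuation F p < 1) (e : F →ₐ[PadicBase F p hp] NormedAlgClosure F) {x : F}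
    (hx : x ∈ 𝒪[F]) : ‖e x‖ ≤ 1 := by
  rw [norm_algHom_eq, NormedAlgClosure.norm_algebraMap]
  exact (norm_le_one_iff F x).2 hx

/-- `‖e x‖ ≤ 1` in `ℂ_F` for `x ∈ 𝒪_F`. [cite: NeukirchANT1999, Ch. II (4.8)] -/
theorem norm_coe_algHom_le_one (hp : valuation F p < 1) (e : F →ₐ[PadicBase F p hp] NormedAlgClosure F) {x : F}
    (hx : x ∈ 𝒪[F]) : ‖((e x : NormedAlgClosure F) : CompletedAlgClosure F)‖ ≤ 1 := by
  rw [UniformSpace.Completion.norm_coe]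
  exact norm_algHom_le_one hp e hx

/-! ## §2 The Teichmüller system of `k_F` in `W(k_F)` -/

variable (F p) in
/-- **`[ι x] ∈ W(k_F)`**: the Teichmüller lift of `x ∈ k_F ⊆ k̄`, a `Γ_F`-fixed Witt vector. [cite: SerreLocalFields1979, Ch. II §4 Prop. 8] -/
def teichmullerFixed (x : 𝓀[F]) : wittFixed F p :=
  ⟨teichmuller p (residueFieldEmb F x), teichmuller_mem_wittFixed fun σ => residueGal_residueFieldEmb σ x⟩

omit [CharZero F] in
/-- Unfolding `[ι x]`. [cite: SerreLocalFields1979, Ch. II §4 Prop. 8] -/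
@[simp] theorem coe_teichmullerFixed (x : 𝓀[F]) :
    (teichmullerFixed F p x : WittVector p (ResidueField (maxUnramifiedCompletion F))) =
      teichmuller p (residueFieldEmb F x) := rfl

omit [CharZero F] in
/-- `[ι 1] = 1`. [cite: SerreLocalFields1979, Ch. II §4 Prop. 8] -/
theorem teichmullerFixed_one : teichmullerFixed F p (1 : 𝓀[F]) = 1 :=
  Subtype.ext (by rw [coe_teichmullerFixed, map_one, (teichmuller p).map_one]; rfl)

omit [CharZero F] in
/-- `[ι 0] = 0`. [cite: SerreLocalFields1979, Ch. II §4 Prop. 8] -/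
theorem teichmullerFixed_zero : teichmullerFixed F p (0 : 𝓀[F]) = 0 :=
  Subtype.ext (by rw [coe_teichmullerFixed, map_zero, teichmuller_zero]; rfl)

omit [CharZero F] in
/-- `[ι (x y)] = [ι x] [ι y]`. [cite: SerreLocalFields1979, Ch. II §4 Prop. 8] -/
theorem teichmullerFixed_mul (x y : 𝓀[F]) :
    teichmullerFixed F p (x * y) = teichmullerFixed F p x * teichmullerFixed F p y :=
  Subtype.ext (by rw [coe_teichmullerFixed, map_mul, (teichmuller p).map_mul]; rfl)

omit [CharZero F] in
/-- `[ι x] ^ q_F = [ι x]`. [cite: SerreLocalFields1979, Ch. II §4 Prop. 8] -/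
theorem teichmullerFixed_pow_residueFieldCard (x : 𝓀[F]) :
    teichmullerFixed F p x ^ residueFieldCard F = teichmullerFixed F p x :=
  Subtype.ext (by
    rw [SubmonoidClass.coe_pow, coe_teichmullerFixed]
    exact teichmuller_pow_residueFieldCard_eq_of_fixed fun σ => residueGal_residueFieldEmb σ x)

omit [CharZero F] in
set_option maxHeartbeats 2000000 in
/-- **`[ι x] + [ι y] = [ι (x + y)] + p·z` with `z ∈ W(k_F)`** (first Teichmüller digit of the fixed vector `[ι x] + [ι y]`).
[cite: SerreLocalFields1979, Ch. II §5 Prop. 8] -/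
theorem exists_teichmullerFixed_add (hp : valuation F p < 1) (x y : 𝓀[F]) : ∃ z : wittFixed F p,
    teichmullerFixed F p x + teichmullerFixed F p y = teichmullerFixed F p (x + y) + (p : wittFixed F p) * z := by
  obtain ⟨z, hz⟩ := exists_coe_eq_teichmuller_add_natCast_mul hp (teichmullerFixed F p x + teichmullerFixed F p y)
  refine ⟨z, Subtype.ext ?_⟩
  have h0 : ((teichmullerFixed F p x + teichmullerFixed F p y : wittFixed F p) :
      WittVector p (ResidueField (maxUnramifiedCompletion F))).coeff 0 = residueFieldEmb F (x + y) := by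
    rw [Subring.coe_add, WittVector.add_coeff_zero, coe_teichmullerFixed, coe_teichmullerFixed, teichmuller_coeff_zero,
      teichmuller_coeff_zero, map_add]
  rw [hz, h0, Subring.coe_add, Subring.coe_mul, Subring.coe_natCast, coe_teichmullerFixed]

omit [CharZero F] in
set_option maxHeartbeats 2000000 in
/-- `Φ [ι x] + Φ [ι y] = Φ [ι (x + y)] + p·Φ z` for any ring map `Φ` out of `W(k_F)`. [cite: SerreLocalFields1979, Ch. II §5 Prop. 8] -/
theorem exists_map_teichmullerFixed_add (hp : valuation F p < 1) {S : Type*} [Semiring S] (Φ : wittFixed F p →+* S)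
    (x y : 𝓀[F]) : ∃ z : wittFixed F p,
    Φ (teichmullerFixed F p x) + Φ (teichmullerFixed F p y) = Φ (teichmullerFixed F p (x + y)) + (p : S) * Φ z := by
  obtain ⟨z, hz⟩ := exists_teichmullerFixed_add hp x y
  exact ⟨z, by rw [← map_add, hz, map_add, map_mul, map_natCast]⟩

set_option maxHeartbeats 2000000 in
/-- `wittToC [ι x] + wittToC [ι y] = wittToC [ι (x + y)] + p·wittToC z`, `z ∈ W(k_F)`. [cite: SerreLocalFields1979, Ch. II §5 Prop. 8] -/
theorem exists_wittToC_teichmuller_add (hp : valuation F p < 1) (x y : 𝓀[F]) : ∃ z : wittFixed F p,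
    wittToC F p hp (teichmuller p (residueFieldEmb F x)) + wittToC F p hp (teichmuller p (residueFieldEmb F y)) =
      wittToC F p hp (teichmuller p (residueFieldEmb F (x + y))) +
        (p : CompletedAlgClosure F) * wittToC F p hp (z : WittVector p (ResidueField (maxUnramifiedCompletion F))) := by
  obtain ⟨z, hz⟩ := exists_map_teichmullerFixed_add hp ((wittToC F p hp).comp (wittFixed F p).subtype) x y
  refine ⟨z, ?_⟩
  simpa only [RingHom.comp_apply, Subring.coe_subtype, coe_teichmullerFixed] using hz

/-- `x ↦ wittToC [ι x]`, `k_F → ℂ_F`, is injective. [cite: SerreLocalFields1979, Ch. II §5 Thm. 4] -/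
theorem wittToC_teichmuller_residueFieldEmb_injective (hp : valuation F p < 1) :
    Function.Injective fun x : 𝓀[F] => wittToC F p hp (teichmuller p (residueFieldEmb F x)) := by
  haveI : Fact (¬ IsUnit (p : maxUnramifiedCompletion F)) := ⟨not_isUnit_natCast_completion hp⟩
  haveI : CharP (ResidueField (maxUnramifiedCompletion F)) p := charP_residueField_completion
  haveI : IsAdicComplete (Ideal.span {(p : maxUnramifiedCompletion F)}) (maxUnramifiedCompletion F) :=
    isAdicComplete_span_natCast_completion hp (Fact.out : p.Prime).ne_zero
  haveI : Fact (¬ IsUnit (p : integerC F)) := ⟨not_isUnit_natCast_integerC hp⟩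
  haveI : IsAdicComplete (Ideal.span {(p : integerC F)}) (integerC F) := isAdicComplete_integerC_natCast hp
  exact (wittToC_teichmuller_injective hp).comp residueFieldEmb_injective

/-! ## §3 The residue permutation `b_e` of a `ℚ_p`-embedding `e` -/

/-- **`Λ_e := e ∘ (W(k_F) → 𝒪_F ⊆ F) : W(k_F) → F̄ ⊆ ℂ_F`** as a ring map. [cite: SerreLocalFields1979, Ch. II §5 Thm. 4] -/
def algHomWittC (hp : valuation F p < 1) (e : F →ₐ[PadicBase F p hp] NormedAlgClosure F) :
    wittFixed F p →+* CompletedAlgClosure F :=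
  ((UniformSpace.Completion.coeRingHom : NormedAlgClosure F →+* CompletedAlgClosure F).comp e.toRingHom).comp
    (wittFixedToF F p hp)

/-- Unfolding `Λ_e`. [cite: SerreLocalFields1979, Ch. II §5 Thm. 4] -/
theorem algHomWittC_apply (hp : valuation F p < 1) (e : F →ₐ[PadicBase F p hp] NormedAlgClosure F) (w : wittFixed F p) :
    algHomWittC hp e w = ((e (wittFixedToF F p hp w) : NormedAlgClosure F) : CompletedAlgClosure F) := rfl

/-- `‖Λ_e w‖ ≤ 1`. [cite: NeukirchANT1999, Ch. II (4.8)] -/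
theorem norm_algHomWittC_le_one (hp : valuation F p < 1) (e : F →ₐ[PadicBase F p hp] NormedAlgClosure F)
    (w : wittFixed F p) : ‖algHomWittC hp e w‖ ≤ 1 := by
  rw [algHomWittC_apply]
  exact norm_coe_algHom_le_one hp e (wittFixedToF_mem_integer hp w)

/-- `Λ_e [ι x]` is a root of `X^{q_F} − X` in `ℂ_F`, hence `= wittToC [ι y]` for some `y ∈ k_F`.
[cite: SerreLocalFields1979, Ch. II §4 Prop. 8] -/
theorem exists_algHomWittC_teichmullerFixed_eq (hp : valuation F p < 1) (e : F →ₐ[PadicBase F p hp] NormedAlgClosure F)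
    (x : 𝓀[F]) : ∃ y : 𝓀[F],
      algHomWittC hp e (teichmullerFixed F p x) = wittToC F p hp (teichmuller p (residueFieldEmb F y)) := by
  haveI : Fact (¬ IsUnit (p : maxUnramifiedCompletion F)) := ⟨not_isUnit_natCast_completion hp⟩
  haveI : CharP (ResidueField (maxUnramifiedCompletion F)) p := charP_residueField_completion
  haveI : IsAdicComplete (Ideal.span {(p : maxUnramifiedCompletion F)}) (maxUnramifiedCompletion F) :=
    isAdicComplete_span_natCast_completion hp (Fact.out : p.Prime).ne_zero
  haveI : Fact (¬ IsUnit (p : integerC F)) := ⟨not_isUnit_natCast_integerC hp⟩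
  haveI : IsAdicComplete (Ideal.span {(p : integerC F)}) (integerC F) := isAdicComplete_integerC_natCast hp
  refine exists_eq_wittToC_teichmuller_of_pow_eq hp ?_
  rw [← map_pow, teichmullerFixed_pow_residueFieldCard]

/-- The function `b_e : k_F → k_F` (auxiliary; see `residuePerm`). [cite: SerreLocalFields1979, Ch. II §5 Thm. 4] -/
private def residuePermFun (hp : valuation F p < 1) (e : F →ₐ[PadicBase F p hp] NormedAlgClosure F) (x : 𝓀[F]) : 𝓀[F] :=
  Classical.choose (exists_algHomWittC_teichmullerFixed_eq hp e x)

/-- Defining property of `b_e`. [cite: SerreLocalFields1979, Ch. II §5 Thm. 4] -/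
private theorem residuePermFun_spec (hp : valuation F p < 1) (e : F →ₐ[PadicBase F p hp] NormedAlgClosure F) (x : 𝓀[F]) :
    algHomWittC hp e (teichmullerFixed F p x) = wittToC F p hp (teichmuller p (residueFieldEmb F (residuePermFun hp e x))) :=
  Classical.choose_spec (exists_algHomWittC_teichmullerFixed_eq hp e x)

/-- `b_e 1 = 1`. [cite: SerreLocalFields1979, Ch. II §5 Thm. 4] -/
private theorem residuePermFun_one (hp : valuation F p < 1) (e : F →ₐ[PadicBase F p hp] NormedAlgClosure F) :
    residuePermFun hp e 1 = 1 := by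
  apply wittToC_teichmuller_residueFieldEmb_injective hp
  change wittToC F p hp (teichmuller p (residueFieldEmb F (residuePermFun hp e 1))) =
    wittToC F p hp (teichmuller p (residueFieldEmb F 1))
  rw [← residuePermFun_spec, teichmullerFixed_one, map_one, map_one, (teichmuller p).map_one, map_one]

/-- `b_e 0 = 0`. [cite: SerreLocalFields1979, Ch. II §5 Thm. 4] -/
private theorem residuePermFun_zero (hp : valuation F p < 1) (e : F →ₐ[PadicBase F p hp] NormedAlgClosure F) :
    residuePermFun hp e 0 = 0 := by
  apply wittToC_teichmuller_residueFieldEmb_injective hp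
  change wittToC F p hp (teichmuller p (residueFieldEmb F (residuePermFun hp e 0))) =
    wittToC F p hp (teichmuller p (residueFieldEmb F 0))
  rw [← residuePermFun_spec, teichmullerFixed_zero, map_zero, map_zero, teichmuller_zero, map_zero]

/-- `b_e (x y) = b_e x · b_e y`. [cite: SerreLocalFields1979, Ch. II §5 Thm. 4] -/
private theorem residuePermFun_mul (hp : valuation F p < 1) (e : F →ₐ[PadicBase F p hp] NormedAlgClosure F) (x y : 𝓀[F]) :
    residuePermFun hp e (x * y) = residuePermFun hp e x * residuePermFun hp e y := by
  apply wittToC_teichmuller_residueFieldEmb_injective hp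
  change wittToC F p hp (teichmuller p (residueFieldEmb F (residuePermFun hp e (x * y)))) =
    wittToC F p hp (teichmuller p (residueFieldEmb F (residuePermFun hp e x * residuePermFun hp e y)))
  rw [← residuePermFun_spec, teichmullerFixed_mul, map_mul, residuePermFun_spec, residuePermFun_spec, ← map_mul,
    ← (teichmuller p).map_mul, ← map_mul]

set_option maxHeartbeats 2000000 in
/-- Additivity of `b_e`: `[ι b(x+y)] − [ι (b x + b y)] ∈ p·𝒪_{ℂ_F}` and Teichmüller lifts are separated modulo `𝔪_{ℂ_F}`.
[cite: SerreLocalFields1979, Ch. II §5 Thm. 4] -/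
private theorem residuePermFun_add (hp : valuation F p < 1) (e : F →ₐ[PadicBase F p hp] NormedAlgClosure F) (x y : 𝓀[F]) :
    residuePermFun hp e (x + y) = residuePermFun hp e x + residuePermFun hp e y := by
  haveI : Fact (¬ IsUnit (p : maxUnramifiedCompletion F)) := ⟨not_isUnit_natCast_completion hp⟩
  haveI : CharP (ResidueField (maxUnramifiedCompletion F)) p := charP_residueField_completion
  haveI : IsAdicComplete (Ideal.span {(p : maxUnramifiedCompletion F)}) (maxUnramifiedCompletion F) :=
    isAdicComplete_span_natCast_completion hp (Fact.out : p.Prime).ne_zero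
  haveI : Fact (¬ IsUnit (p : integerC F)) := ⟨not_isUnit_natCast_integerC hp⟩
  haveI : IsAdicComplete (Ideal.span {(p : integerC F)}) (integerC F) := isAdicComplete_integerC_natCast hp
  obtain ⟨z, hz⟩ := exists_map_teichmullerFixed_add hp (algHomWittC hp e) x y
  obtain ⟨z', hz'⟩ := exists_wittToC_teichmuller_add hp (residuePermFun hp e x) (residuePermFun hp e y)
  rw [residuePermFun_spec, residuePermFun_spec, residuePermFun_spec] at hz
  have key : wittToC F p hp (teichmuller p (residueFieldEmb F (residuePermFun hp e (x + y)))) -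
      wittToC F p hp (teichmuller p (residueFieldEmb F (residuePermFun hp e x + residuePermFun hp e y))) =
      (p : CompletedAlgClosure F) *
        (wittToC F p hp (z' : WittVector p (ResidueField (maxUnramifiedCompletion F))) - algHomWittC hp e z) := by
    linear_combination hz' - hz
  apply residueFieldEmb_injective
  refine teichmuller_eq_of_norm_wittToC_sub_lt_one hp ?_
  rw [key, norm_mul]
  have h1 : ‖wittToC F p hp (z' : WittVector p (ResidueField (maxUnramifiedCompletion F))) - algHomWittC hp e z‖ ≤ 1 := by
    rw [sub_eq_add_neg]
    refine (IsUltrametricDist.norm_add_le_max _ _).trans (max_le (norm_wittToC_le_one hp _) ?_)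
    rw [norm_neg]
    exact norm_algHomWittC_le_one hp e z
  calc ‖(p : CompletedAlgClosure F)‖ *
        ‖wittToC F p hp (z' : WittVector p (ResidueField (maxUnramifiedCompletion F))) - algHomWittC hp e z‖
      ≤ ‖(p : CompletedAlgClosure F)‖ * 1 := mul_le_mul_of_nonneg_left h1 (norm_nonneg _)
    _ < 1 := by rw [mul_one]; exact norm_natCast_C_lt_one hp

/-- **The residue permutation `b_e : k_F →+* k_F` of a `ℚ_p`-embedding `e : F → F̄`**, characterised by
`e [ι x] = wittToC [ι (b_e x)]` in `ℂ_F` (`algHomWittC_teichmullerFixed`). [cite: SerreLocalFields1979, Ch. II §5 Thm. 4] -/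
def residuePerm (hp : valuation F p < 1) (e : F →ₐ[PadicBase F p hp] NormedAlgClosure F) : 𝓀[F] →+* 𝓀[F] where
  toFun := residuePermFun hp e
  map_one' := residuePermFun_one hp e
  map_mul' := residuePermFun_mul hp e
  map_zero' := residuePermFun_zero hp e
  map_add' := residuePermFun_add hp e

/-- ★ **`e [ι x] = wittToC [ι (b_e x)]` in `ℂ_F`.** [cite: SerreLocalFields1979, Ch. II §5 Thm. 4] -/
theorem algHomWittC_teichmullerFixed (hp : valuation F p < 1) (e : F →ₐ[PadicBase F p hp] NormedAlgClosure F) (x : 𝓀[F]) :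
    algHomWittC hp e (teichmullerFixed F p x) = wittToC F p hp (teichmuller p (residueFieldEmb F (residuePerm hp e x))) :=
  residuePermFun_spec hp e x

/-! ## §4 `b_e` is a power of the absolute Frobenius -/

omit [CharZero F] in
/-- **Every ring endomorphism of the finite field `k_F` is `x ↦ x^{p^n}`** (Mathlib: the `𝔽_p`-algebra endomorphisms of
a finite field are the powers of the Frobenius, `FiniteField.bijective_frobeniusAlgHom_pow`). [cite: SerreLocalFields1979, Ch. II §5 Cor. to Thm. 3] -/
theorem exists_ringHom_residueField_eq_pow (hp : valuation F p < 1) (b : 𝓀[F] →+* 𝓀[F]) :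
    ∃ n : ℕ, ∀ x : 𝓀[F], b x = x ^ p ^ n := by
  classical
  haveI : CharP 𝓀[F] p := charP_residueField hp
  haveI : NeZero p := ⟨(Fact.out : p.Prime).ne_zero⟩
  letI : Algebra (ZMod p) 𝓀[F] := ZMod.algebra 𝓀[F] p
  have hcomm : b.comp (algebraMap (ZMod p) 𝓀[F]) = algebraMap (ZMod p) 𝓀[F] := Subsingleton.elim _ _
  let b' : 𝓀[F] →ₐ[ZMod p] 𝓀[F] :=
    { b with commutes' := fun c => RingHom.congr_fun hcomm c }
  obtain ⟨⟨n, hnlt⟩, hn⟩ := (FiniteField.bijective_frobeniusAlgHom_pow (ZMod p) 𝓀[F]).2 b'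
  refine ⟨n, fun x => ?_⟩
  have h1 := DFunLike.congr_fun hn x
  simp only at h1
  rw [AlgHom.coe_pow, FiniteField.coe_frobeniusAlgHom, pow_iterate, ZMod.card] at h1
  exact h1.symm

/-- **`b_e = Frob_p^n` for some `n`.** [cite: SerreLocalFields1979, Ch. II §5 Cor. to Thm. 3] -/
theorem exists_residuePerm_eq_pow (hp : valuation F p < 1) (e : F →ₐ[PadicBase F p hp] NormedAlgClosure F) :
    ∃ n : ℕ, ∀ x : 𝓀[F], residuePerm hp e x = x ^ p ^ n :=
  exists_ringHom_residueField_eq_pow hp (residuePerm hp e)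

omit [CharZero F] in
/-- `φ^n [a] = [a^{p^n}]` in `W(k̄)`. [cite: SerreLocalFields1979, Ch. II §6 Thm. 7] -/
theorem iterate_frobenius_teichmuller [CharP (ResidueField (maxUnramifiedCompletion F)) p]
    (a : ResidueField (maxUnramifiedCompletion F)) (n : ℕ) :
    (⇑(frobenius : WittVector p (ResidueField (maxUnramifiedCompletion F)) →+*
      WittVector p (ResidueField (maxUnramifiedCompletion F))))^[n] (teichmuller p a) = teichmuller p (a ^ p ^ n) := by
  induction n with
  | zero => rw [Function.iterate_zero_apply, pow_zero, pow_one]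
  | succ n ih =>
    rw [Function.iterate_succ_apply', ih, WittVector.frobenius_eq_map_frobenius, WittVector.map_teichmuller,
      frobenius_def, pow_succ, pow_mul]

/-- **`e [a] = wittToC (φ^n [a])` on Teichmüller lifts of fixed residues**, `n` the Frobenius exponent of `b_e`.
[cite: SerreLocalFields1979, Ch. II §5 Thm. 4] -/
theorem exists_algHomWittC_teichmuller_eq_iterate_frobenius (hp : valuation F p < 1)
    (e : F →ₐ[PadicBase F p hp] NormedAlgClosure F) : ∃ n : ℕ, ∀ x : 𝓀[F],
      algHomWittC hp e (teichmullerFixed F p x) =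
        wittToC F p hp ((⇑(frobenius : WittVector p (ResidueField (maxUnramifiedCompletion F)) →+*
          WittVector p (ResidueField (maxUnramifiedCompletion F))))^[n] (teichmuller p (residueFieldEmb F x))) := by
  haveI : Fact (¬ IsUnit (p : maxUnramifiedCompletion F)) := ⟨not_isUnit_natCast_completion hp⟩
  haveI : CharP (ResidueField (maxUnramifiedCompletion F)) p := charP_residueField_completion
  obtain ⟨n, hn⟩ := exists_residuePerm_eq_pow hp e
  refine ⟨n, fun x => ?_⟩
  rw [algHomWittC_teichmullerFixed, hn, iterate_frobenius_teichmuller, map_pow]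

/-! ## §5 Rigidity: ring maps `W(k_F) → 𝒪_{ℂ_F}` are determined on Teichmüller lifts -/

omit [CharZero F] in
set_option maxHeartbeats 4000000 in
/-- **Two ring maps `Λ, μ : W(k_F) → ℂ_F` with values of norm `≤ 1` which agree on the Teichmüller lifts `[a]`,
`a ∈ k̄^{Γ_F}`, are equal**: expanding `w = Σ_{i<m} [a_i] p^i + p^m w_m` gives `Λ w − μ w = p^m (Λ w_m − μ w_m)`, of
norm `≤ ‖p‖^m → 0`. [cite: SerreLocalFields1979, Ch. II §5 Prop. 8, Thm. 4] -/
theorem ringHom_wittFixed_ext (hp : valuation F p < 1) {Λ μ : wittFixed F p →+* CompletedAlgClosure F}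
    (hΛ : ∀ z, ‖Λ z‖ ≤ 1) (hμ : ∀ z, ‖μ z‖ ≤ 1)
    (h : ∀ (w : wittFixed F p) (a : ResidueField (maxUnramifiedCompletion F)),
      (w : WittVector p (ResidueField (maxUnramifiedCompletion F))) = teichmuller p a → Λ w = μ w) :
    Λ = μ := by
  refine RingHom.ext fun w => ?_
  have hp1 : ‖(p : CompletedAlgClosure F)‖ < 1 := norm_natCast_C_lt_one hp
  have hdiff : ∀ y : wittFixed F p, ‖Λ y - μ y‖ ≤ 1 := fun y => by
    rw [sub_eq_add_neg]
    refine (IsUltrametricDist.norm_add_le_max _ _).trans (max_le (hΛ y) ?_)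
    rw [norm_neg]; exact hμ y
  have key : ∀ m : ℕ, ‖Λ w - μ w‖ ≤ ‖(p : CompletedAlgClosure F)‖ ^ m := by
    intro m
    obtain ⟨a, y, ha, hx⟩ := exists_coe_eq_sum_teichmuller_add hp w m
    have hw : w = (∑ i ∈ Finset.range m,
        (⟨teichmuller p (a i), teichmuller_mem_wittFixed (ha i)⟩ : wittFixed F p) * (p : wittFixed F p) ^ i) +
          (p : wittFixed F p) ^ m * y := by
      apply Subtype.ext
      simp only [Subring.coe_add, Subring.coe_mul, AddSubmonoidClass.coe_finsetSum, SubmonoidClass.coe_pow,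
        Subring.coe_natCast, hx]
    have hΛμ : Λ w - μ w = (p : CompletedAlgClosure F) ^ m * (Λ y - μ y) := by
      have hs : ∑ i ∈ Finset.range m,
          Λ ((⟨teichmuller p (a i), teichmuller_mem_wittFixed (ha i)⟩ : wittFixed F p) * (p : wittFixed F p) ^ i) =
          ∑ i ∈ Finset.range m,
            μ ((⟨teichmuller p (a i), teichmuller_mem_wittFixed (ha i)⟩ : wittFixed F p) * (p : wittFixed F p) ^ i) :=
        Finset.sum_congr rfl fun i _ => by rw [map_mul, map_mul, map_pow, map_pow, map_natCast, map_natCast, h _ (a i) rfl]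
      rw [hw, map_add, map_add, map_sum, map_sum, hs, map_mul, map_mul, map_pow, map_pow, map_natCast, map_natCast]
      ring
    calc ‖Λ w - μ w‖ = ‖(p : CompletedAlgClosure F)‖ ^ m * ‖Λ y - μ y‖ := by rw [hΛμ, norm_mul, norm_pow]
      _ ≤ ‖(p : CompletedAlgClosure F)‖ ^ m * 1 := mul_le_mul_of_nonneg_left (hdiff y) (pow_nonneg (norm_nonneg _) m)
      _ = ‖(p : CompletedAlgClosure F)‖ ^ m := mul_one _
  by_contra hne
  have hpos : 0 < ‖Λ w - μ w‖ := norm_pos_iff.2 (sub_ne_zero.2 hne)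
  obtain ⟨m, hm⟩ := exists_pow_lt_of_lt_one hpos hp1
  exact absurd (lt_of_lt_of_le hm (key m)) (lt_irrefl _)

/-! ## §6 ★ The classification `e|_{W(k_F)} = θ ∘ φ^j` -/

omit [CharZero F] in
/-- `φ^n w = φ^{n mod f} w` on `W(k_F)` (`φ^f = id` there, tree `iterate_frobenius_coe_wittFixed`). [cite: SerreLocalFields1979, Ch. II §5 Thm. 3] -/
theorem iterate_frobenius_coe_wittFixed_mod [CharP (ResidueField (maxUnramifiedCompletion F)) p] {f : ℕ}
    (hq : residueFieldCard F = p ^ f) (w : wittFixed F p) (n : ℕ) :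
    (⇑(frobenius : WittVector p (ResidueField (maxUnramifiedCompletion F)) →+*
      WittVector p (ResidueField (maxUnramifiedCompletion F))))^[n]
        (w : WittVector p (ResidueField (maxUnramifiedCompletion F))) =
      (⇑(frobenius : WittVector p (ResidueField (maxUnramifiedCompletion F)) →+*
        WittVector p (ResidueField (maxUnramifiedCompletion F))))^[n % f]
          (w : WittVector p (ResidueField (maxUnramifiedCompletion F))) := by
  have hfix : ∀ k : ℕ, (⇑(frobenius : WittVector p (ResidueField (maxUnramifiedCompletion F)) →+*
      WittVector p (ResidueField (maxUnramifiedCompletion F))))^[f * k]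
        (w : WittVector p (ResidueField (maxUnramifiedCompletion F))) = w := by
    intro k
    induction k with
    | zero => rw [mul_zero, Function.iterate_zero_apply]
    | succ k ih => rw [Nat.mul_succ, Function.iterate_add_apply, iterate_frobenius_coe_wittFixed hq, ih]
  conv_lhs => rw [← Nat.mod_add_div n f, Function.iterate_add_apply, hfix]

set_option maxHeartbeats 4000000 in
/-- ★★ **Classification of `ℚ_p`-embeddings on `W(k_F)`**: if `q_F = p^f`, then for every `ℚ_p`-algebra map
`e : F → F̄` there is `j < f` with `e(w) = c_j(w) = θ(φ^j w)` in `ℂ_F` for all `w ∈ W(k_F) ⊆ 𝒪_F` — the restriction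
of `e` to the maximal unramified subfield `F₀ = W(k_F)[1/p]` is the `j`-th power of its Frobenius.
[cite: SerreLocalFields1979, Ch. III §5 Thm. 3; Ch. II §5 Thm. 4] -/
theorem exists_algHom_eq_twistCoeff [Fact (¬ IsUnit (p : integerC F))]
    [IsAdicComplete (Ideal.span {(p : integerC F)}) (integerC F)] (hp : valuation F p < 1) {f : ℕ}
    (hq : residueFieldCard F = p ^ f) (e : F →ₐ[PadicBase F p hp] NormedAlgClosure F) :
    ∃ j < f, ∀ w : wittFixed F p,
      ((e (wittFixedToF F p hp w) : NormedAlgClosure F) : CompletedAlgClosure F) =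
        ((twistCoeff hp j w : integerC F) : CompletedAlgClosure F) := by
  haveI : Fact (¬ IsUnit (p : maxUnramifiedCompletion F)) := ⟨not_isUnit_natCast_completion hp⟩
  haveI : CharP (ResidueField (maxUnramifiedCompletion F)) p := charP_residueField_completion
  have hf : 0 < f := by
    rcases Nat.eq_zero_or_pos f with h0 | h0
    · exfalso
      have h1 := one_lt_residueFieldCard F
      rw [hq, h0, pow_zero] at h1
      exact lt_irrefl _ h1
    · exact h0
  obtain ⟨n, hn⟩ := exists_algHomWittC_teichmuller_eq_iterate_frobenius hp e
  refine ⟨n % f, Nat.mod_lt n hf, fun w => ?_⟩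
  have hext : algHomWittC hp e = (integerC F).subtype.comp (twistCoeff hp (n % f)) := by
    refine ringHom_wittFixed_ext hp (norm_algHomWittC_le_one hp e) (fun z => norm_coe_integerC_le _) ?_
    intro w a hwa
    have hfixed : ∀ σ : absoluteGaloisGroup F, residueGal σ a = a := fun σ => by
      have h1 := residueGal_coeff_zero_coe_wittFixed σ w
      rwa [hwa, teichmuller_coeff_zero] at h1
    obtain ⟨x, rfl⟩ := exists_residueFieldEmb_eq_of_fixed hfixed
    have hw : w = teichmullerFixed F p x := Subtype.ext hwa
    rw [hw, hn, RingHom.comp_apply, Subring.coe_subtype, coe_twistCoeff, coe_teichmullerFixed,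
      ← coe_teichmullerFixed, iterate_frobenius_coe_wittFixed_mod hq]
  have h := RingHom.congr_fun hext w
  rw [algHomWittC_apply, RingHom.comp_apply, Subring.coe_subtype] at h
  exact h

end Literature.NumberTheory.PAdicHodge

end
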